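import Mathlib

/-!
# PneNP / OverlapGapAlgebra — crux `SolvableImpliesStableSection` (stmt-PneNP-2463):
# the MONOTONE REPAIR block (9/·) — the repair dynamics: flips, repairs, new violations

Support for crux `stmt-PneNP-2463` (`Summit.PneNP.PneNP.Theses.OverlapGapAlgebra.SolvableImpliesStableSection`):
the f-free block "bounded-round monotone repair gives stable sections up to `α ≤ 2^k/(4k)`".
MONOTONE REPAIR on an instance `Φ : Fin m → Fin k → Fin n × Bool`: all variables start `true`; at
every round, every violated clause with a negative slot sets the variable of its LEAST negative slot to
`false`.  The values are an opaque `val : ℕ → instances → Fin n → Bool` specified by `hval0`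
(round `0`: all `true`) and `hvalS` (`v` is `true` at round `t+1` iff it is `true` at round `t` and is
not FLIPPED at round `t`, i.e. is not the least-negative-slot variable of a clause violated at round
`t`).  Consequences:

* `sissR_leastNeg_exists` — a clause with a negative slot has a least one;
* `sissR_val_mono`, `sissR_val_false_of_le` — values only go from `true` to `false`;
* `sissR_flip_props`, `sissR_exists_flip`, `sissR_flip_unique` — a flipped variable is `true` before
  and `false` after; a `false` variable was flipped at an earlier round; the flip round is unique;
* `sissR_not_viol_after` — a violated clause with a negative slot is satisfied at all later rounds;
* `sissR_newly_violated` — a newly violated clause has a positive slot whose variable was flipped at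
  the preceding round; `sissR_flipper_new` — a violated clause with a negative slot at round `t ≥ 1`
  was satisfied at round `t - 1`.
No definitions (all objects are hypotheses); axioms `propext`, `Classical.choice`, `Quot.sound`.
-/

set_option linter.dupNamespace false -- `Summit.PneNP.PneNP.…`: summit = sub-problem (D-0017)

namespace Summit.PneNP.PneNP.Theorems

open Finset
open scoped Classical

section Dynamics

variable {m k n : ℕ}

/-- A clause with a negative slot has a LEAST negative slot. -/
theorem sissR_leastNeg_exists (Φ : (Fin m → Fin k → Fin n × Bool)) (i : Fin m) (h : ∃ j : Fin k, (Φ i j).2 = false) :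
    ∃ j : Fin k, (Φ i j).2 = false ∧ ∀ j' : Fin k, j' < j → (Φ i j').2 = true := by
  set C := (univ : Finset (Fin k)).filter fun j => (Φ i j).2 = false with hC
  have hne : C.Nonempty := by
    obtain ⟨j, hj⟩ := h
    exact ⟨j, by rw [hC, Finset.mem_filter]; exact ⟨mem_univ _, hj⟩⟩
  refine ⟨C.min' hne, (Finset.mem_filter.1 (C.min'_mem hne)).2, fun j' hj' => ?_⟩
  by_contra hcon
  have hmem : j' ∈ C := by
    rw [hC, Finset.mem_filter]
    exact ⟨mem_univ _, by simpa using hcon⟩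
  exact absurd (C.min'_le j' hmem) (not_le.2 hj')

/-- The least negative slot is unique. -/
theorem sissR_leastNeg_unique (Φ : (Fin m → Fin k → Fin n × Bool)) (i : Fin m) (j₁ j₂ : Fin k)
    (h₁ : (Φ i j₁).2 = false ∧ ∀ j' : Fin k, j' < j₁ → (Φ i j').2 = true)
    (h₂ : (Φ i j₂).2 = false ∧ ∀ j' : Fin k, j' < j₂ → (Φ i j').2 = true) : j₁ = j₂ := by
  rcases lt_trichotomy j₁ j₂ with h | h | h
  · have := h₂.2 j₁ h; rw [h₁.1] at this; exact absurd this (by simp)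
  · exact h
  · have := h₁.2 j₂ h; rw [h₂.1] at this; exact absurd this (by simp)

/-- **Values only decrease**: `true` at round `t + 1` implies `true` at round `t`. -/
theorem sissR_val_mono (val : ℕ → (Fin m → Fin k → Fin n × Bool) → Fin n → Bool)
    (hvalS : ∀ (t : ℕ) (Φ : (Fin m → Fin k → Fin n × Bool)) (v : Fin n), val (t + 1) Φ v = true ↔
      (val t Φ v = true ∧ ¬ (∃ ii : Fin m, (∀ jj : Fin k, val t Φ (Φ ii jj).1 ≠ (Φ ii jj).2) ∧
        ∃ jf : Fin k, (Φ ii jf).2 = false ∧ (∀ j' : Fin k, j' < jf → (Φ ii j').2 = true) ∧ (Φ ii jf).1 = v)))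
    (Φ : (Fin m → Fin k → Fin n × Bool)) (v : Fin n) (t : ℕ) : ∀ d : ℕ, val (t + d) Φ v = true → val t Φ v = true := by
  intro d
  induction d with
  | zero => exact id
  | succ d ih => exact fun h => ih ((hvalS (t + d) Φ v).1 h).1

/-- `false` at round `t` implies `false` at every round `t' ≥ t`. -/
theorem sissR_val_false_of_le (val : ℕ → (Fin m → Fin k → Fin n × Bool) → Fin n → Bool)
    (hvalS : ∀ (t : ℕ) (Φ : (Fin m → Fin k → Fin n × Bool)) (v : Fin n), val (t + 1) Φ v = true ↔
      (val t Φ v = true ∧ ¬ (∃ ii : Fin m, (∀ jj : Fin k, val t Φ (Φ ii jj).1 ≠ (Φ ii jj).2) ∧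
        ∃ jf : Fin k, (Φ ii jf).2 = false ∧ (∀ j' : Fin k, j' < jf → (Φ ii j').2 = true) ∧ (Φ ii jf).1 = v)))
    (Φ : (Fin m → Fin k → Fin n × Bool)) (v : Fin n) (t t' : ℕ) (htt : t ≤ t') (h : val t Φ v = false) : val t' Φ v = false := by
  obtain ⟨d, rfl⟩ := Nat.exists_eq_add_of_le htt
  cases hv : val (t + d) Φ v
  · rfl
  · have := sissR_val_mono val hvalS Φ v t d hv
    rw [h] at this
    exact absurd this (by simp)

/-- **A flipped variable is `true` at its flip round and `false` from the next round on.** -/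
theorem sissR_flip_props (val : ℕ → (Fin m → Fin k → Fin n × Bool) → Fin n → Bool)
    (hvalS : ∀ (t : ℕ) (Φ : (Fin m → Fin k → Fin n × Bool)) (v : Fin n), val (t + 1) Φ v = true ↔
      (val t Φ v = true ∧ ¬ (∃ ii : Fin m, (∀ jj : Fin k, val t Φ (Φ ii jj).1 ≠ (Φ ii jj).2) ∧
        ∃ jf : Fin k, (Φ ii jf).2 = false ∧ (∀ j' : Fin k, j' < jf → (Φ ii j').2 = true) ∧ (Φ ii jf).1 = v)))
    (Φ : (Fin m → Fin k → Fin n × Bool)) (v : Fin n) (s : ℕ) (hfl : (∃ ii : Fin m, (∀ jj : Fin k, val s Φ (Φ ii jj).1 ≠ (Φ ii jj).2) ∧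
        ∃ jf : Fin k, (Φ ii jf).2 = false ∧ (∀ j' : Fin k, j' < jf → (Φ ii j').2 = true) ∧ (Φ ii jf).1 = v)) :
    val s Φ v = true ∧ val (s + 1) Φ v = false := by
  constructor
  · obtain ⟨i, hviol, j, hsj, _, hv⟩ := hfl
    have := hviol j
    rw [hv, hsj] at this
    cases h : val s Φ v
    · exact absurd h this
    · rfl
  · cases h : val (s + 1) Φ v
    · rfl
    · exact absurd hfl ((hvalS s Φ v).1 h).2

/-- **A `false` variable was flipped**: if `val t Φ v = false` then `v` was `true` and flipped at some
round `s < t`. -/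
theorem sissR_exists_flip (val : ℕ → (Fin m → Fin k → Fin n × Bool) → Fin n → Bool)
    (hval0 : ∀ (Φ : (Fin m → Fin k → Fin n × Bool)) (v : Fin n), val 0 Φ v = true)
    (hvalS : ∀ (t : ℕ) (Φ : (Fin m → Fin k → Fin n × Bool)) (v : Fin n), val (t + 1) Φ v = true ↔
      (val t Φ v = true ∧ ¬ (∃ ii : Fin m, (∀ jj : Fin k, val t Φ (Φ ii jj).1 ≠ (Φ ii jj).2) ∧
        ∃ jf : Fin k, (Φ ii jf).2 = false ∧ (∀ j' : Fin k, j' < jf → (Φ ii j').2 = true) ∧ (Φ ii jf).1 = v)))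
    (Φ : (Fin m → Fin k → Fin n × Bool)) (v : Fin n) :
    ∀ t : ℕ, val t Φ v = false → ∃ s : ℕ, s < t ∧ (∃ ii : Fin m, (∀ jj : Fin k, val s Φ (Φ ii jj).1 ≠ (Φ ii jj).2) ∧
        ∃ jf : Fin k, (Φ ii jf).2 = false ∧ (∀ j' : Fin k, j' < jf → (Φ ii j').2 = true) ∧ (Φ ii jf).1 = v) := by
  intro t
  induction t with
  | zero =>
    intro h
    rw [hval0] at h
    exact absurd h (by simp)
  | succ t ih =>
    intro h
    cases ht : val t Φ v
    · obtain ⟨s, hs, hfl⟩ := ih ht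
      exact ⟨s, Nat.lt_succ_of_lt hs, hfl⟩
    · refine ⟨t, Nat.lt_succ_self t, ?_⟩
      by_contra hcon
      have := (hvalS t Φ v).2 ⟨ht, hcon⟩
      rw [h] at this
      exact absurd this (by simp)

/-- **The flip round is unique.** -/
theorem sissR_flip_unique (val : ℕ → (Fin m → Fin k → Fin n × Bool) → Fin n → Bool)
    (hvalS : ∀ (t : ℕ) (Φ : (Fin m → Fin k → Fin n × Bool)) (v : Fin n), val (t + 1) Φ v = true ↔
      (val t Φ v = true ∧ ¬ (∃ ii : Fin m, (∀ jj : Fin k, val t Φ (Φ ii jj).1 ≠ (Φ ii jj).2) ∧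
        ∃ jf : Fin k, (Φ ii jf).2 = false ∧ (∀ j' : Fin k, j' < jf → (Φ ii j').2 = true) ∧ (Φ ii jf).1 = v)))
    (Φ : (Fin m → Fin k → Fin n × Bool)) (v : Fin n) (s s' : ℕ) (hs : (∃ ii : Fin m, (∀ jj : Fin k, val s Φ (Φ ii jj).1 ≠ (Φ ii jj).2) ∧
        ∃ jf : Fin k, (Φ ii jf).2 = false ∧ (∀ j' : Fin k, j' < jf → (Φ ii j').2 = true) ∧ (Φ ii jf).1 = v)) (hs' : (∃ ii : Fin m, (∀ jj : Fin k, val s' Φ (Φ ii jj).1 ≠ (Φ ii jj).2) ∧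
        ∃ jf : Fin k, (Φ ii jf).2 = false ∧ (∀ j' : Fin k, j' < jf → (Φ ii j').2 = true) ∧ (Φ ii jf).1 = v)) :
    s = s' := by
  by_contra hne
  rcases Nat.lt_or_gt_of_ne hne with h | h
  · have h1 := (sissR_flip_props val hvalS Φ v s hs).2
    have h2 := (sissR_flip_props val hvalS Φ v s' hs').1
    have := sissR_val_false_of_le val hvalS Φ v (s + 1) s' h h1
    rw [h2] at this
    exact absurd this (by simp)
  · have h1 := (sissR_flip_props val hvalS Φ v s' hs').2
    have h2 := (sissR_flip_props val hvalS Φ v s hs).1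
    have := sissR_val_false_of_le val hvalS Φ v (s' + 1) s h h1
    rw [h2] at this
    exact absurd this (by simp)

/-- **A repaired clause stays satisfied.** A clause violated at round `t` that has a negative slot is
not violated at any later round (its least-negative-slot variable is flipped to `false` for good). -/
theorem sissR_not_viol_after (val : ℕ → (Fin m → Fin k → Fin n × Bool) → Fin n → Bool)
    (hvalS : ∀ (t : ℕ) (Φ : (Fin m → Fin k → Fin n × Bool)) (v : Fin n), val (t + 1) Φ v = true ↔
      (val t Φ v = true ∧ ¬ (∃ ii : Fin m, (∀ jj : Fin k, val t Φ (Φ ii jj).1 ≠ (Φ ii jj).2) ∧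
        ∃ jf : Fin k, (Φ ii jf).2 = false ∧ (∀ j' : Fin k, j' < jf → (Φ ii j').2 = true) ∧ (Φ ii jf).1 = v)))
    (Φ : (Fin m → Fin k → Fin n × Bool)) (i : Fin m) (t : ℕ) (hviol : (∀ jj : Fin k, val t Φ (Φ i jj).1 ≠ (Φ i jj).2)) (hneg : ∃ j : Fin k, (Φ i j).2 = false)
    (t' : ℕ) (htt : t < t') : ¬ (∀ jj : Fin k, val t' Φ (Φ i jj).1 ≠ (Φ i jj).2) := by
  obtain ⟨j₀, hj₀, hlt⟩ := sissR_leastNeg_exists Φ i hneg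
  have hfl : (∃ ii : Fin m, (∀ jj : Fin k, val t Φ (Φ ii jj).1 ≠ (Φ ii jj).2) ∧
        ∃ jf : Fin k, (Φ ii jf).2 = false ∧ (∀ j' : Fin k, j' < jf → (Φ ii j').2 = true) ∧ (Φ ii jf).1 = (Φ i j₀).1) := ⟨i, hviol, j₀, hj₀, hlt, rfl⟩
  have hfalse := sissR_val_false_of_le val hvalS Φ (Φ i j₀).1 (t + 1) t' htt
    (sissR_flip_props val hvalS Φ _ t hfl).2
  intro hv
  have := hv j₀
  rw [hfalse, hj₀] at this
  exact this rfl

/-- **A newly violated clause was broken by a flip.** If `i` is satisfied at round `t` and violated at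
round `t + 1`, then some POSITIVE slot of `i` carries a variable flipped at round `t`. -/
theorem sissR_newly_violated (val : ℕ → (Fin m → Fin k → Fin n × Bool) → Fin n → Bool)
    (hvalS : ∀ (t : ℕ) (Φ : (Fin m → Fin k → Fin n × Bool)) (v : Fin n), val (t + 1) Φ v = true ↔
      (val t Φ v = true ∧ ¬ (∃ ii : Fin m, (∀ jj : Fin k, val t Φ (Φ ii jj).1 ≠ (Φ ii jj).2) ∧
        ∃ jf : Fin k, (Φ ii jf).2 = false ∧ (∀ j' : Fin k, j' < jf → (Φ ii j').2 = true) ∧ (Φ ii jf).1 = v)))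
    (Φ : (Fin m → Fin k → Fin n × Bool)) (i : Fin m) (t : ℕ) (hsat : ¬ (∀ jj : Fin k, val t Φ (Φ i jj).1 ≠ (Φ i jj).2)) (hviol : (∀ jj : Fin k, val (t + 1) Φ (Φ i jj).1 ≠ (Φ i jj).2)) :
    ∃ j : Fin k, (Φ i j).2 = true ∧ (∃ ii : Fin m, (∀ jj : Fin k, val t Φ (Φ ii jj).1 ≠ (Φ ii jj).2) ∧
        ∃ jf : Fin k, (Φ ii jf).2 = false ∧ (∀ j' : Fin k, j' < jf → (Φ ii j').2 = true) ∧ (Φ ii jf).1 = (Φ i j).1) := by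
  push Not at hsat
  obtain ⟨j, hj⟩ := hsat
  have hj' := hviol j
  refine ⟨j, ?_, ?_⟩
  · -- the value changed, hence went from `true` to `false`; the sign is the old value
    cases ht : val t Φ (Φ i j).1
    · have := sissR_val_false_of_le val hvalS Φ _ t (t + 1) (Nat.le_succ t) ht
      rw [this] at hj'
      rw [ht] at hj
      exact absurd hj.symm (fun h => hj' h.symm)
    · rw [ht] at hj
      exact hj.symm
  · cases ht : val t Φ (Φ i j).1
    · have := sissR_val_false_of_le val hvalS Φ _ t (t + 1) (Nat.le_succ t) ht
      rw [this] at hj'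
      rw [ht] at hj
      exact absurd hj.symm (fun h => hj' h.symm)
    · by_contra hcon
      have h1 := (hvalS t Φ (Φ i j).1).2 ⟨ht, hcon⟩
      rw [ht] at hj
      rw [h1] at hj'
      exact hj' hj

/-- **A flipping clause is newly violated.** A clause violated at round `t ≥ 1` that has a negative
slot was not violated at round `t - 1`. -/
theorem sissR_flipper_new (val : ℕ → (Fin m → Fin k → Fin n × Bool) → Fin n → Bool)
    (hvalS : ∀ (t : ℕ) (Φ : (Fin m → Fin k → Fin n × Bool)) (v : Fin n), val (t + 1) Φ v = true ↔
      (val t Φ v = true ∧ ¬ (∃ ii : Fin m, (∀ jj : Fin k, val t Φ (Φ ii jj).1 ≠ (Φ ii jj).2) ∧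
        ∃ jf : Fin k, (Φ ii jf).2 = false ∧ (∀ j' : Fin k, j' < jf → (Φ ii j').2 = true) ∧ (Φ ii jf).1 = v)))
    (Φ : (Fin m → Fin k → Fin n × Bool)) (i : Fin m) (t : ℕ) (ht : 1 ≤ t) (hviol : (∀ jj : Fin k, val t Φ (Φ i jj).1 ≠ (Φ i jj).2))
    (hneg : ∃ j : Fin k, (Φ i j).2 = false) : ¬ (∀ jj : Fin k, val (t - 1) Φ (Φ i jj).1 ≠ (Φ i jj).2) :=
  fun h => sissR_not_viol_after val hvalS Φ i (t - 1) h hneg t (Nat.sub_one_lt_of_le ht le_rfl) hviol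

end Dynamics

end Summit.PneNP.PneNP.Theorems
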